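import Summits.QuantumFields.YangMills.Theorems.SwapVirialDeficitBlowUpGnomonicAngleChartDefs
import Summits.QuantumFields.YangMills.Theorems.SwapVirialDeficitBlowUpGnomonicFollowerHessian
import HarnessLib

/-!
# W4, part K7f: JETS ALONG JOINT ANGLE–LETTER LINES — the hub ANGLE as one more gnomonic letter, uniform down to the apex
# (free-hands support of ⟨stmt-QuantumFields-24197⟩ `SwapVirialDeficit.SwapGluedStiffness`; cell ym-idea-1, skeleton ➎ `stub_core_tip` (T2-hub): the tip slab is matched to the
# adjacent bulk shell by moving the hub angle `ψ` through the apex `ψ = 0`, LEAD memo10b; K7d ✓`taylor_four_gnoDeficit_hubLine` moves the hub along the REAL shift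
# `a − (sδ₁)·1`, whose jets cost `(|δ₁|∕‖im a‖)ᵏ` — unbounded at the tip)

In the angle chart ✓`gnoDeficitAng z χ θ ε η` (✓`…AngleChartDefs`: leaders `(Q x̂, Q(Ā(θ)·x̂·A(θ)·ẑ), Q ŷ, Q A(θ))`, `A(θ) = cos θ + sin θ·i`) the hub unit moves on the
circle: `s ↦ A(θ₀ + sθ₁)` carries a 4-jet of size `|θ₁|` (§1, ✓`hasDerivAt_angUnit_affine`), for EVERY `θ₀` — no `1∕‖im a‖`.  The rest is K7d verbatim:
* §1 ★ `jet4_angUnit_line`;  §2 ★★ `jet4_leader_angLine` (every leader: size `2|θ₁| + Σ letter sizes`), `jet4_follower_angLine` (hub-free);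
* §3 ★★ `realJet4_gnoDeficitAng_line_le`, ★★★ `taylor_four_gnoDeficitAng_line` — for `ψ(s) = gnoDeficitAng z χ (θ₀ + sθ₁) ε (η + sξ)` with `|θ₁| ≤ S` and all letter
  sizes `≤ S`: `|ψ′| ≤ 1008L⁴S`, `|ψ″| ≤ 39984L⁴S²`, `|ψ‴| ≤ 6816096L⁴S³`, `|ψ⁗| ≤ 1464571584L⁴S⁴` everywhere, and the two Taylor remainders at `s = 0`;
* §4 ★★ `contDiff_gnoDeficitAng` — `(θ, η) ↦ gnoDeficitAng z χ θ ε η` is `C^n` on `ℝ × GnoCoord L`; ★★ `gnoDeficitAng_third_bound_norm` — the ambient cube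
  `|D³F̂(p)[w,w,w]| ≤ 40896576L⁴‖w‖³` on `ℝ × GnoCoord L` (sup norm; `(√3)³ ≤ 6`).
The hub-angle Lipschitz law of the follower Hessian and of its log-determinant is the sequel `…FollowerHessianAngle`.

HONEST LABEL: calculus plumbing (no measure); nothing about `stub_core_tip`, ⟨24197⟩ ∕ ⟨24194⟩ (OPEN) is proved; own crux ⟨22884⟩ OPEN (blocked-on ⟨19935⟩); the
Yang–Mills mass gap is NOT proved; no summit is proved by a line.  THEOREMS ONLY (0 `def`, 0 `sorry`), standard axioms, no local instances.
Width seat ym-line-sfw-p2-w2 g60 (cell ym-idea-1, free hands), `--supports stmt-QuantumFields-24197`.  References: [cite: Luscher1983, §2]; [folklore].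
-/

set_option autoImplicit false

noncomputable section

open Quaternion Set
open scoped Quaternion RealInnerProductSpace BigOperators ContDiff
open Literature.MathematicalPhysics.QuantumLattice
open Literature.MathematicalPhysics.QuantumFieldTheory hiding SU2
open Literature.Analysis.Calculus (radialUnit radialUnit_def norm_radialUnit)
open Summit.QuantumFields.YangMills.Theorems.FemtoTransferGap
open Summit.QuantumFields.YangMills.Theorems.FemtoTransferGap.TT
open Summit.QuantumFields.YangMills.Theorems.SwapTwistDeficit.ToronLog (axisPoint)
open Summit.QuantumFields.YangMills.Theorems.SwapVirialDeficit.ZeroModeSigma (su2Quat_quatToSU2_eq_radialUnit slaveP norm_axisUnit dil3 dil3_apply)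
open Summit.QuantumFields.YangMills.Theorems.SwapVirialDeficit.BlowUp (leaderTuple dil3_one' dilateIm_one_apply qDeficit swapRingDeficit_eq_qDeficit)
open Summit.QuantumFields.YangMills.Theorems.SwapVirialDeficit.BlowUpRing

namespace Summit.QuantumFields.YangMills.Theorems.SwapVirialDeficit.Gnomonic

variable {L : ℕ} [NeZero L]

/-! ## §1 The hub unit along an affine angle -/

/-- `su2Quat (quatToSU2 A(θ)) = A(θ)`. [folklore] -/
theorem su2Quat_quatToSU2_angUnit (θ : ℝ) : su2Quat (quatToSU2 (angUnit θ)) = angUnit θ := by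
  rw [su2Quat_quatToSU2_eq_radialUnit (angUnit_ne_zero θ), radialUnit_def, norm_angUnit, inv_one, one_smul]

/-- ★ **THE HUB UNIT CARRIES A 4-JET OF SIZE `|θ₁|`** along `s ↦ A(θ₀ + sθ₁)`, for EVERY `θ₀` (each derivative is the next quarter-turn times `θ₁`). [folklore] -/
theorem jet4_angUnit_line (θ₀ θ₁ : ℝ) :
    ∃ f₁ f₂ f₃ f₄ : ℝ → ℍ, (∀ s, HasDerivAt (fun s : ℝ => su2Quat (quatToSU2 (angUnit (θ₀ + s * θ₁)))) (f₁ s) s) ∧ (∀ s, HasDerivAt f₁ (f₂ s) s) ∧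
      (∀ s, HasDerivAt f₂ (f₃ s) s) ∧ (∀ s, HasDerivAt f₃ (f₄ s) s) ∧
      ∀ s, ‖su2Quat (quatToSU2 (angUnit (θ₀ + s * θ₁)))‖ ≤ 1 ∧ ‖f₁ s‖ ≤ |θ₁| ∧ ‖f₂ s‖ ≤ |θ₁| ^ 2 ∧ ‖f₃ s‖ ≤ 3 * |θ₁| ^ 3 ∧ ‖f₄ s‖ ≤ 9 * |θ₁| ^ 4 := by
  have hd : ∀ (k : ℕ) (c : ℝ) (s : ℝ), HasDerivAt (fun s : ℝ => θ₁ ^ k • angUnit (θ₀ + s * θ₁ + c)) (θ₁ ^ (k + 1) • angUnit (θ₀ + s * θ₁ + (c + Real.pi / 2))) s :=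
    fun k c s => by
    have h := (hasDerivAt_angUnit_affine θ₀ θ₁ c s).const_smul (θ₁ ^ k)
    rw [smul_smul, ← pow_succ, add_assoc] at h
    exact h
  have hn : ∀ (k : ℕ) (c s : ℝ), ‖θ₁ ^ k • angUnit (θ₀ + s * θ₁ + c)‖ = |θ₁| ^ k := fun k c s => by
    rw [norm_smul, norm_angUnit, mul_one, norm_pow, Real.norm_eq_abs]
  have e0 : (fun s : ℝ => su2Quat (quatToSU2 (angUnit (θ₀ + s * θ₁)))) = fun s => θ₁ ^ 0 • angUnit (θ₀ + s * θ₁ + 0) :=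
    funext fun s => by rw [su2Quat_quatToSU2_angUnit, pow_zero, one_smul, add_zero]
  refine ⟨fun s => θ₁ ^ 1 • angUnit (θ₀ + s * θ₁ + (0 + Real.pi / 2)), fun s => θ₁ ^ 2 • angUnit (θ₀ + s * θ₁ + (0 + Real.pi / 2 + Real.pi / 2)),
    fun s => θ₁ ^ 3 • angUnit (θ₀ + s * θ₁ + (0 + Real.pi / 2 + Real.pi / 2 + Real.pi / 2)),
    fun s => θ₁ ^ 4 • angUnit (θ₀ + s * θ₁ + (0 + Real.pi / 2 + Real.pi / 2 + Real.pi / 2 + Real.pi / 2)), fun s => ?_, fun s => hd 1 _ s, fun s => hd 2 _ s,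
    fun s => hd 3 _ s, fun s => ⟨?_, ?_, ?_, ?_, ?_⟩⟩
  · rw [e0]; exact hd 0 0 s
  · rw [su2Quat_quatToSU2_angUnit, norm_angUnit]
  · rw [hn, pow_one]
  · rw [hn]
  · rw [hn]; nlinarith [pow_nonneg (abs_nonneg θ₁) 3]
  · rw [hn]; nlinarith [pow_nonneg (abs_nonneg θ₁) 4]

/-! ## §2 Leaders and followers along a joint angle–letter line -/

omit [NeZero L] in
/-- ★★ **LEADER JETS ALONG A JOINT ANGLE–LETTER LINE**: every leader of `angChartPoint (θ₀ + sθ₁) ε (η + s • ξ)` carries, as a function of `s`, a 4-jet of size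
`2|θ₁| + √Σ(ξ.1.1)ₖ² + √Σ(ξ.1.2)ₖ² + √Σ(ξ.2.1)ₖ²` — for EVERY `θ₀` (apex included). [folklore] -/
theorem jet4_leader_angLine (θ₀ θ₁ : ℝ) (ε : BlowUpRing.GnoSign L) (η ξ : BlowUpRing.GnoCoord L) (μ : Fin 4) :
    ∃ f₁ f₂ f₃ f₄ : ℝ → ℍ,
      (∀ s, HasDerivAt (fun s : ℝ => su2Quat ((angChartPoint (θ₀ + s * θ₁) ε (η + s • ξ)).1 μ)) (f₁ s) s) ∧
      (∀ s, HasDerivAt f₁ (f₂ s) s) ∧ (∀ s, HasDerivAt f₂ (f₃ s) s) ∧ (∀ s, HasDerivAt f₃ (f₄ s) s) ∧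
      ∀ s, ‖su2Quat ((angChartPoint (θ₀ + s * θ₁) ε (η + s • ξ)).1 μ)‖ ≤ 1 ∧
        ‖f₁ s‖ ≤ 2 * |θ₁| + Real.sqrt (∑ k, ξ.1.1 k ^ 2) + Real.sqrt (∑ k, ξ.1.2 k ^ 2) + Real.sqrt (∑ k, ξ.2.1 k ^ 2) ∧
        ‖f₂ s‖ ≤ (2 * |θ₁| + Real.sqrt (∑ k, ξ.1.1 k ^ 2) + Real.sqrt (∑ k, ξ.1.2 k ^ 2) + Real.sqrt (∑ k, ξ.2.1 k ^ 2)) ^ 2 ∧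
        ‖f₃ s‖ ≤ 3 * (2 * |θ₁| + Real.sqrt (∑ k, ξ.1.1 k ^ 2) + Real.sqrt (∑ k, ξ.1.2 k ^ 2) + Real.sqrt (∑ k, ξ.2.1 k ^ 2)) ^ 3 ∧
        ‖f₄ s‖ ≤ 9 * (2 * |θ₁| + Real.sqrt (∑ k, ξ.1.1 k ^ 2) + Real.sqrt (∑ k, ξ.1.2 k ^ 2) + Real.sqrt (∑ k, ξ.2.1 k ^ 2)) ^ 4 := by
  have hH : 0 ≤ |θ₁| := abs_nonneg _
  have hx : 0 ≤ Real.sqrt (∑ k, ξ.1.1 k ^ 2) := Real.sqrt_nonneg _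
  have hy : 0 ≤ Real.sqrt (∑ k, ξ.1.2 k ^ 2) := Real.sqrt_nonneg _
  have hz : 0 ≤ Real.sqrt (∑ k, ξ.2.1 k ^ 2) := Real.sqrt_nonneg _
  match μ with
  | ⟨0, _⟩ =>
    have e : ∀ s : ℝ, su2Quat (quatToSU2 (gnoLetter ε.1.1 (η.1.1 + s • ξ.1.1))) = su2Quat ((angChartPoint (θ₀ + s * θ₁) ε (η + s • ξ)).1 ⟨0, by omega⟩) :=
      fun s => rfl
    have h := jet4_mono hx (show _ ≤ 2 * |θ₁| + Real.sqrt (∑ k, ξ.1.1 k ^ 2) + Real.sqrt (∑ k, ξ.1.2 k ^ 2) + Real.sqrt (∑ k, ξ.2.1 k ^ 2) by linarith)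
      (jet4_gnoLetterLine ε.1.1 η.1.1 ξ.1.1)
    simpa only [e] using h
  | ⟨1, _⟩ =>
    -- the slaved letter `Ā(s)·x̂(s)·A(s)·ẑ(s)` with the hub unit MOVING ON THE CIRCLE
    have hA := jet4_angUnit_line θ₀ θ₁
    have h3 := jet4_mul (by positivity) hz
      (jet4_mul (by positivity) hH (jet4_mul hH hx (jet4_star hA) (jet4_gnoLetterLine ε.1.1 η.1.1 ξ.1.1)) hA)
      (jet4_gnoLetterLine ε.2.1 η.2.1 ξ.2.1)
    have e : ∀ s : ℝ, star (su2Quat (quatToSU2 (angUnit (θ₀ + s * θ₁)))) * su2Quat (quatToSU2 (gnoLetter ε.1.1 (η.1.1 + s • ξ.1.1))) *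
        su2Quat (quatToSU2 (angUnit (θ₀ + s * θ₁))) * su2Quat (quatToSU2 (gnoLetter ε.2.1 (η.2.1 + s • ξ.2.1))) =
        su2Quat ((angChartPoint (θ₀ + s * θ₁) ε (η + s • ξ)).1 ⟨1, by omega⟩) := fun s => by
      rw [su2Quat_quatToSU2_angUnit]
      exact (su2Quat_quatToSU2_slaveP_mul (norm_angUnit _) (gnoLetter_ne_zero _ _) (gnoLetter_ne_zero _ _)).symm
    have h := jet4_mono (by positivity) (show |θ₁| + Real.sqrt (∑ k, ξ.1.1 k ^ 2) + |θ₁| + Real.sqrt (∑ k, ξ.2.1 k ^ 2) ≤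
        2 * |θ₁| + Real.sqrt (∑ k, ξ.1.1 k ^ 2) + Real.sqrt (∑ k, ξ.1.2 k ^ 2) + Real.sqrt (∑ k, ξ.2.1 k ^ 2) by linarith) h3
    simpa only [e] using h
  | ⟨2, _⟩ =>
    have e : ∀ s : ℝ, su2Quat (quatToSU2 (gnoLetter ε.1.2 (η.1.2 + s • ξ.1.2))) = su2Quat ((angChartPoint (θ₀ + s * θ₁) ε (η + s • ξ)).1 ⟨2, by omega⟩) :=
      fun s => rfl
    have h := jet4_mono hy (show _ ≤ 2 * |θ₁| + Real.sqrt (∑ k, ξ.1.1 k ^ 2) + Real.sqrt (∑ k, ξ.1.2 k ^ 2) + Real.sqrt (∑ k, ξ.2.1 k ^ 2) by linarith)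
      (jet4_gnoLetterLine ε.1.2 η.1.2 ξ.1.2)
    simpa only [e] using h
  | ⟨3, _⟩ =>
    have e : ∀ s : ℝ, su2Quat (quatToSU2 (angUnit (θ₀ + s * θ₁))) = su2Quat ((angChartPoint (θ₀ + s * θ₁) ε (η + s • ξ)).1 ⟨3, by omega⟩) := fun s => rfl
    have h := jet4_mono hH (show |θ₁| ≤ 2 * |θ₁| + Real.sqrt (∑ k, ξ.1.1 k ^ 2) + Real.sqrt (∑ k, ξ.1.2 k ^ 2) + Real.sqrt (∑ k, ξ.2.1 k ^ 2) by linarith)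
      (jet4_angUnit_line θ₀ θ₁)
    simpa only [e] using h

omit [NeZero L] in
/-- ★ **FOLLOWER JETS ALONG A JOINT ANGLE–LETTER LINE** (the followers do not see the hub): size `√Σ(ξ.2.2 i)ₖ²`. [folklore] -/
theorem jet4_follower_angLine (θ₀ θ₁ : ℝ) (ε : BlowUpRing.GnoSign L) (η ξ : BlowUpRing.GnoCoord L) (i : BlowUpRing.Fol L) :
    ∃ f₁ f₂ f₃ f₄ : ℝ → ℍ,
      (∀ s, HasDerivAt (fun s : ℝ => su2Quat ((angChartPoint (θ₀ + s * θ₁) ε (η + s • ξ)).2 i)) (f₁ s) s) ∧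
      (∀ s, HasDerivAt f₁ (f₂ s) s) ∧ (∀ s, HasDerivAt f₂ (f₃ s) s) ∧ (∀ s, HasDerivAt f₃ (f₄ s) s) ∧
      ∀ s, ‖su2Quat ((angChartPoint (θ₀ + s * θ₁) ε (η + s • ξ)).2 i)‖ ≤ 1 ∧
        ‖f₁ s‖ ≤ Real.sqrt (∑ k, ξ.2.2 i k ^ 2) ∧ ‖f₂ s‖ ≤ Real.sqrt (∑ k, ξ.2.2 i k ^ 2) ^ 2 ∧ ‖f₃ s‖ ≤ 3 * Real.sqrt (∑ k, ξ.2.2 i k ^ 2) ^ 3 ∧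
        ‖f₄ s‖ ≤ 9 * Real.sqrt (∑ k, ξ.2.2 i k ^ 2) ^ 4 := by
  have e : ∀ s : ℝ, su2Quat (quatToSU2 (gnoLetter (ε.2.2 i) (η.2.2 i + s • ξ.2.2 i))) = su2Quat ((angChartPoint (θ₀ + s * θ₁) ε (η + s • ξ)).2 i) :=
    fun s => rfl
  have h := jet4_gnoLetterLine (ε.2.2 i) (η.2.2 i) (ξ.2.2 i)
  simpa only [e] using h

/-! ## §3 The joint 4-jet of the angle deficit and its Taylor data -/

set_option maxHeartbeats 400000 in
/-- ★★ **FOUR DERIVATIVE WITNESSES OF `s ↦ F̂(θ₀ + sθ₁; ε, η + s·ξ)`**, bounded by `1008L⁴S`, `39984L⁴S²`, `6816096L⁴S³`, `1464571584L⁴S⁴` when `|θ₁| ≤ S` and all letter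
sizes of `ξ` are `≤ S` (leaders `≤ 5S`, followers `≤ S`, words `≤ 7S`; ✓`jet4_fixHistory`, ✓`realJet4_qDeficit_le`) — for EVERY `θ₀`. [cite: Luscher1983, §2] -/
theorem realJet4_gnoDeficitAng_line_le (z : Fin 3 → Bool) (χ : Site 3 L → SU2) (θ₀ θ₁ : ℝ) (ε : GnoSign L) (η ξ : GnoCoord L) {S : ℝ}
    (hS : 0 ≤ S) (hθ : |θ₁| ≤ S) (hx : Real.sqrt (∑ k, ξ.1.1 k ^ 2) ≤ S) (hy : Real.sqrt (∑ k, ξ.1.2 k ^ 2) ≤ S) (hz : Real.sqrt (∑ k, ξ.2.1 k ^ 2) ≤ S)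
    (hf : ∀ i, Real.sqrt (∑ k, ξ.2.2 i k ^ 2) ≤ S) :
    ∃ d₁ d₂ d₃ d₄ : ℝ → ℝ, (∀ s, HasDerivAt (fun s : ℝ => gnoDeficitAng z χ (θ₀ + s * θ₁) ε (η + s • ξ)) (d₁ s) s) ∧
      (∀ s, HasDerivAt d₁ (d₂ s) s) ∧ (∀ s, HasDerivAt d₂ (d₃ s) s) ∧ (∀ s, HasDerivAt d₃ (d₄ s) s) ∧
      ∀ s, |d₁ s| ≤ 1008 * (L : ℝ) ^ 4 * S ∧ |d₂ s| ≤ 39984 * (L : ℝ) ^ 4 * S ^ 2 ∧ |d₃ s| ≤ 6816096 * (L : ℝ) ^ 4 * S ^ 3 ∧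
        |d₄ s| ≤ 1464571584 * (L : ℝ) ^ 4 * S ^ 4 := by
  -- the letters: leaders `≤ 5S`, followers `≤ S`
  have hC : ∀ μ : Fin 4, ∃ f₁ f₂ f₃ f₄ : ℝ → ℍ,
      (∀ s, HasDerivAt (fun s : ℝ => su2Quat ((angChartPoint (θ₀ + s * θ₁) ε (η + s • ξ)).1 μ)) (f₁ s) s) ∧
      (∀ s, HasDerivAt f₁ (f₂ s) s) ∧ (∀ s, HasDerivAt f₂ (f₃ s) s) ∧ (∀ s, HasDerivAt f₃ (f₄ s) s) ∧
      ∀ s, ‖su2Quat ((angChartPoint (θ₀ + s * θ₁) ε (η + s • ξ)).1 μ)‖ ≤ 1 ∧ ‖f₁ s‖ ≤ 5 * S ∧ ‖f₂ s‖ ≤ (5 * S) ^ 2 ∧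
        ‖f₃ s‖ ≤ 3 * (5 * S) ^ 3 ∧ ‖f₄ s‖ ≤ 9 * (5 * S) ^ 4 :=
    fun μ => jet4_mono (by positivity) (by linarith) (jet4_leader_angLine θ₀ θ₁ ε η ξ μ)
  have hU : ∀ i : Fol L, ∃ f₁ f₂ f₃ f₄ : ℝ → ℍ,
      (∀ s, HasDerivAt (fun s : ℝ => su2Quat ((angChartPoint (θ₀ + s * θ₁) ε (η + s • ξ)).2 i)) (f₁ s) s) ∧
      (∀ s, HasDerivAt f₁ (f₂ s) s) ∧ (∀ s, HasDerivAt f₂ (f₃ s) s) ∧ (∀ s, HasDerivAt f₃ (f₄ s) s) ∧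
      ∀ s, ‖su2Quat ((angChartPoint (θ₀ + s * θ₁) ε (η + s • ξ)).2 i)‖ ≤ 1 ∧ ‖f₁ s‖ ≤ S ∧ ‖f₂ s‖ ≤ S ^ 2 ∧
        ‖f₃ s‖ ≤ 3 * S ^ 3 ∧ ‖f₄ s‖ ≤ 9 * S ^ 4 :=
    fun i => jet4_mono (Real.sqrt_nonneg _) (hf i) (jet4_follower_angLine θ₀ θ₁ ε η ξ i)
  -- the words and the deficit
  obtain ⟨hl, hs⟩ := jet4_fixHistory (C := fun s => (angChartPoint (L := L) (θ₀ + s * θ₁) ε (η + s • ξ)).1)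
    (U := fun s => (angChartPoint (L := L) (θ₀ + s * θ₁) ε (η + s • ξ)).2) χ (by positivity : (0 : ℝ) ≤ 5 * S) hS hC hU
  have e7 : 5 * S + S + S = 7 * S := by ring
  rw [e7] at hl hs
  have h := realJet4_qDeficit_le (L := L) z (M := 7 * S) (by positivity)
    (Q := fun s => ((fun (i : Fin (2 * L - 1 + 1)) (e : Edge 3 L) =>
        su2Quat ((fixHistory (ringConfig χ (angChartPoint (L := L) (θ₀ + s * θ₁) ε (η + s • ξ)))).1 i e)),
      fun x : Site 3 L => su2Quat ((fixHistory (ringConfig χ (angChartPoint (L := L) (θ₀ + s * θ₁) ε (η + s • ξ)))).2 x)))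
    (fun i e => hl i e) (fun x => hs x)
  have e : (fun s : ℝ => gnoDeficitAng z χ (θ₀ + s * θ₁) ε (η + s • ξ)) = fun s => qDeficit z
      ((fun (i : Fin (2 * L - 1 + 1)) (e : Edge 3 L) =>
          su2Quat ((fixHistory (ringConfig χ (angChartPoint (L := L) (θ₀ + s * θ₁) ε (η + s • ξ)))).1 i e)),
        fun x : Site 3 L => su2Quat ((fixHistory (ringConfig χ (angChartPoint (L := L) (θ₀ + s * θ₁) ε (η + s • ξ)))).2 x)) :=
    funext fun s => swapRingDeficit_eq_qDeficit z _
  rw [e]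
  refine realJet4_mono ?_ ?_ ?_ ?_ h
  · nlinarith [pow_nonneg (Nat.cast_nonneg L : (0 : ℝ) ≤ L) 4]
  · nlinarith [pow_nonneg (Nat.cast_nonneg L : (0 : ℝ) ≤ L) 4, sq_nonneg S]
  · nlinarith [pow_nonneg (Nat.cast_nonneg L : (0 : ℝ) ≤ L) 4, pow_nonneg hS 3]
  · nlinarith [pow_nonneg (Nat.cast_nonneg L : (0 : ℝ) ≤ L) 4, pow_nonneg hS 4]

/-- ★★★ **THE ANGLE DEFICIT IS `C⁴`-BOUNDED ALONG JOINT ANGLE–LETTER LINES, UNIFORMLY IN THE HUB ANGLE** (apex included): for every `θ₀`, signs `ε`, base point `η`,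
direction `ξ` with letter sizes `≤ S`, angle speed `|θ₁| ≤ S`, and `ψ s = gnoDeficitAng z χ (θ₀ + sθ₁) ε (η + s • ξ)`:
`|ψ′| ≤ 1008L⁴S`, `|ψ″| ≤ 39984L⁴S²`, `|ψ‴| ≤ 6816096L⁴S³`, `|ψ⁗| ≤ 1464571584L⁴S⁴` EVERYWHERE, and at `s = 0`
`|ψ 1 − ψ 0 − ψ′ 0 − ψ″ 0∕2| ≤ 6816096L⁴S³∕2`, `|ψ 1 − ψ 0 − ψ′ 0 − ψ″ 0∕2 − ψ‴ 0∕6| ≤ 1464571584L⁴S⁴∕6`. [cite: Luscher1983, §2] -/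
theorem taylor_four_gnoDeficitAng_line (z : Fin 3 → Bool) (χ : Site 3 L → SU2) (θ₀ θ₁ : ℝ) (ε : GnoSign L) (η ξ : GnoCoord L) {S : ℝ}
    (hS : 0 ≤ S) (hθ : |θ₁| ≤ S) (hx : Real.sqrt (∑ k, ξ.1.1 k ^ 2) ≤ S) (hy : Real.sqrt (∑ k, ξ.1.2 k ^ 2) ≤ S) (hz : Real.sqrt (∑ k, ξ.2.1 k ^ 2) ≤ S)
    (hf : ∀ i, Real.sqrt (∑ k, ξ.2.2 i k ^ 2) ≤ S) :
    (∀ s, |deriv (fun s : ℝ => gnoDeficitAng z χ (θ₀ + s * θ₁) ε (η + s • ξ)) s| ≤ 1008 * (L : ℝ) ^ 4 * S ∧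
        |iteratedDeriv 2 (fun s : ℝ => gnoDeficitAng z χ (θ₀ + s * θ₁) ε (η + s • ξ)) s| ≤ 39984 * (L : ℝ) ^ 4 * S ^ 2 ∧
        |iteratedDeriv 3 (fun s : ℝ => gnoDeficitAng z χ (θ₀ + s * θ₁) ε (η + s • ξ)) s| ≤ 6816096 * (L : ℝ) ^ 4 * S ^ 3 ∧
        |iteratedDeriv 4 (fun s : ℝ => gnoDeficitAng z χ (θ₀ + s * θ₁) ε (η + s • ξ)) s| ≤ 1464571584 * (L : ℝ) ^ 4 * S ^ 4) ∧
      |gnoDeficitAng z χ (θ₀ + θ₁) ε (η + ξ) - gnoDeficitAng z χ θ₀ ε η - deriv (fun s : ℝ => gnoDeficitAng z χ (θ₀ + s * θ₁) ε (η + s • ξ)) 0 -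
          iteratedDeriv 2 (fun s : ℝ => gnoDeficitAng z χ (θ₀ + s * θ₁) ε (η + s • ξ)) 0 / 2| ≤ 6816096 * (L : ℝ) ^ 4 * S ^ 3 / 2 ∧
      |gnoDeficitAng z χ (θ₀ + θ₁) ε (η + ξ) - gnoDeficitAng z χ θ₀ ε η - deriv (fun s : ℝ => gnoDeficitAng z χ (θ₀ + s * θ₁) ε (η + s • ξ)) 0 -
          iteratedDeriv 2 (fun s : ℝ => gnoDeficitAng z χ (θ₀ + s * θ₁) ε (η + s • ξ)) 0 / 2 -
          iteratedDeriv 3 (fun s : ℝ => gnoDeficitAng z χ (θ₀ + s * θ₁) ε (η + s • ξ)) 0 / 6| ≤ 1464571584 * (L : ℝ) ^ 4 * S ^ 4 / 6 := by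
  obtain ⟨d₁, d₂, d₃, d₄, h₁, h₂, h₃, h₄, hb⟩ := realJet4_gnoDeficitAng_line_le z χ θ₀ θ₁ ε η ξ hS hθ hx hy hz hf
  obtain ⟨e1, e2, e3, e4⟩ := iteratedDeriv_eq_of_hasDerivAt_chain h₁ h₂ h₃ h₄
  have e1' : gnoDeficitAng z χ (θ₀ + θ₁) ε (η + ξ) = (fun s : ℝ => gnoDeficitAng z χ (θ₀ + s * θ₁) ε (η + s • ξ)) 1 := by
    simp only [one_smul, one_mul]
  have e0' : gnoDeficitAng z χ θ₀ ε η = (fun s : ℝ => gnoDeficitAng z χ (θ₀ + s * θ₁) ε (η + s • ξ)) 0 := by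
    simp only [zero_smul, add_zero, zero_mul]
  refine ⟨fun s => ?_, ?_, ?_⟩
  · rw [e1, e2, e3, e4]; exact hb s
  · rw [e1, e2, e1', e0']
    exact abs_taylor_three_remainder_le h₁ h₂ h₃ (fun s _ => (hb s).2.2.1)
  · rw [e1, e2, e3, e1', e0']
    exact abs_taylor_four_remainder_le h₁ h₂ h₃ h₄ (fun s _ => (hb s).2.2.2)

/-! ## §4 Joint smoothness and the ambient cube on `ℝ × GnoCoord L` -/

/-- ★★ **THE ANGLE DEFICIT IS `C^n` JOINTLY IN THE ANGLE AND THE GNOMONIC COORDINATES** on `ℝ × GnoCoord L` (no hypothesis on the angle: the hub unit is entire in `θ`,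
the slaving is a product with a unit, ✓`contDiff_chartDeficit_of_letters`). [cite: Luscher1983, §2] -/
theorem contDiff_gnoDeficitAng (z : Fin 3 → Bool) (χ : Site 3 L → SU2) (ε : GnoSign L) {n : ℕ∞} :
    ContDiff ℝ n fun p : ℝ × GnoCoord L => gnoDeficitAng z χ p.1 ε p.2 := by
  have hx : ContDiff ℝ n fun p : ℝ × GnoCoord L => su2Quat (quatToSU2 (gnoLetter ε.1.1 p.2.1.1)) :=
    (contDiff_radialUnit_gnoLetter ε.1.1).comp (contDiff_fst.comp (contDiff_fst.comp contDiff_snd))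
  have hy : ContDiff ℝ n fun p : ℝ × GnoCoord L => su2Quat (quatToSU2 (gnoLetter ε.1.2 p.2.1.2)) :=
    (contDiff_radialUnit_gnoLetter ε.1.2).comp (contDiff_snd.comp (contDiff_fst.comp contDiff_snd))
  have hz : ContDiff ℝ n fun p : ℝ × GnoCoord L => su2Quat (quatToSU2 (gnoLetter ε.2.1 p.2.2.1)) :=
    (contDiff_radialUnit_gnoLetter ε.2.1).comp (contDiff_fst.comp (contDiff_snd.comp contDiff_snd))
  have hA : ContDiff ℝ n fun p : ℝ × GnoCoord L => angUnit p.1 := (contDiff_angUnit (n := n)).comp contDiff_fst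
  have hAs : ContDiff ℝ n fun p : ℝ × GnoCoord L => star (angUnit p.1) := by
    have e : (fun p : ℝ × GnoCoord L => star (angUnit p.1)) = fun p => angUnit (-p.1) := funext fun p => by
      ext <;> simp [angUnit, Real.cos_neg, Real.sin_neg]
    rw [e]; exact (contDiff_angUnit (n := n)).comp (contDiff_fst.neg)
  have hC : ∀ μ : Fin 4, ContDiff ℝ n fun p : ℝ × GnoCoord L => su2Quat ((angChartPoint p.1 ε p.2).1 μ) := by
    intro μ
    match μ with
    | ⟨0, _⟩ => exact hx
    | ⟨1, _⟩ =>
      have e : ∀ p : ℝ × GnoCoord L, su2Quat ((angChartPoint p.1 ε p.2).1 ⟨1, by omega⟩) =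
          star (angUnit p.1) * su2Quat (quatToSU2 (gnoLetter ε.1.1 p.2.1.1)) * angUnit p.1 * su2Quat (quatToSU2 (gnoLetter ε.2.1 p.2.2.1)) := fun p =>
        su2Quat_quatToSU2_slaveP_mul (norm_angUnit _) (gnoLetter_ne_zero _ _) (gnoLetter_ne_zero _ _)
      simp only [e]
      exact ((hAs.mul hx).mul hA).mul hz
    | ⟨2, _⟩ => exact hy
    | ⟨3, _⟩ =>
      have e : ∀ p : ℝ × GnoCoord L, su2Quat ((angChartPoint p.1 ε p.2).1 ⟨3, by omega⟩) = angUnit p.1 := fun p => su2Quat_quatToSU2_angUnit _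
      simp only [e]; exact hA
  have hU : ∀ i : Fol L, ContDiff ℝ n fun p : ℝ × GnoCoord L => su2Quat ((angChartPoint p.1 ε p.2).2 i) := fun i =>
    (contDiff_radialUnit_gnoLetter (ε.2.2 i)).comp ((contDiff_apply ℝ (Fin 3 → ℝ) i).comp (contDiff_snd.comp (contDiff_snd.comp contDiff_snd)))
  exact contDiff_chartDeficit_of_letters (C := fun p : ℝ × GnoCoord L => (angChartPoint p.1 ε p.2).1) (U := fun p : ℝ × GnoCoord L => (angChartPoint p.1 ε p.2).2)
    z χ hC hU

/-- ★★ **THE AMBIENT CUBE OF THE ANGLE DEFICIT**: `|D³F̂(p)[w,w,w]| ≤ 40896576·L⁴·‖w‖³` at every point `p = (θ, η)` and every direction `w = (θ₁, ξ)` of `ℝ × GnoCoord L`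
(sup norm: `|θ₁| ≤ ‖w‖ ≤ √3‖w‖`, letter sizes `≤ √3‖ξ‖ ≤ √3‖w‖`; `(√3)³ ≤ 6`) — the `hcube` of ✓`abs_hessianForm_sub_le_of_cubes` on the joint space. [cite: Luscher1983, §2] -/
theorem gnoDeficitAng_third_bound_norm (z : Fin 3 → Bool) (χ : Site 3 L → SU2) (ε : GnoSign L) (p w : ℝ × GnoCoord L) :
    |iteratedFDeriv ℝ 3 (fun q : ℝ × GnoCoord L => gnoDeficitAng z χ q.1 ε q.2) p (fun _ => w)| ≤ 40896576 * (L : ℝ) ^ 4 * ‖w‖ ^ 3 := by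
  have e := Literature.Analysis.Calculus.iteratedDeriv_lineRestriction (n := 3) (contDiff_gnoDeficitAng (n := 3) z χ ε) p w 0
  rw [zero_smul, add_zero] at e
  rw [← e]
  -- the line `p + s • w = (p.1 + s * w.1, p.2 + s • w.2)`
  have eline : (fun s : ℝ => gnoDeficitAng z χ (p + s • w).1 ε (p + s • w).2) = fun s : ℝ => gnoDeficitAng z χ (p.1 + s * w.1) ε (p.2 + s • w.2) := by
    funext s; simp only [Prod.fst_add, Prod.snd_add, Prod.smul_fst, Prod.smul_snd, smul_eq_mul]
  rw [eline]
  -- sizes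
  have h3 : 0 ≤ Real.sqrt 3 := Real.sqrt_nonneg _
  have h13 : (1 : ℝ) ≤ Real.sqrt 3 := by
    rw [show (1 : ℝ) = Real.sqrt 1 by rw [Real.sqrt_one]]; exact Real.sqrt_le_sqrt (by norm_num)
  have hw1 : |w.1| ≤ Real.sqrt 3 * ‖w‖ := by
    calc |w.1| = ‖w.1‖ := (Real.norm_eq_abs _).symm
      _ ≤ ‖w‖ := norm_fst_le w
      _ = 1 * ‖w‖ := (one_mul _).symm
      _ ≤ Real.sqrt 3 * ‖w‖ := mul_le_mul_of_nonneg_right h13 (norm_nonneg _)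
  have hw2 : ‖w.2‖ ≤ ‖w‖ := norm_snd_le w
  obtain ⟨hx, hy, hz, hf⟩ := letterSizes_le_norm (L := L) w.2
  have hS : 0 ≤ Real.sqrt 3 * ‖w‖ := by positivity
  have hx' : Real.sqrt (∑ k, w.2.1.1 k ^ 2) ≤ Real.sqrt 3 * ‖w‖ := hx.trans (mul_le_mul_of_nonneg_left hw2 h3)
  have hy' : Real.sqrt (∑ k, w.2.1.2 k ^ 2) ≤ Real.sqrt 3 * ‖w‖ := hy.trans (mul_le_mul_of_nonneg_left hw2 h3)
  have hz' : Real.sqrt (∑ k, w.2.2.1 k ^ 2) ≤ Real.sqrt 3 * ‖w‖ := hz.trans (mul_le_mul_of_nonneg_left hw2 h3)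
  have hf' : ∀ i, Real.sqrt (∑ k, w.2.2.2 i k ^ 2) ≤ Real.sqrt 3 * ‖w‖ := fun i => (hf i).trans (mul_le_mul_of_nonneg_left hw2 h3)
  have h := ((taylor_four_gnoDeficitAng_line z χ p.1 w.1 ε p.2 w.2 hS hw1 hx' hy' hz' hf').1 0).2.2.1
  refine h.trans ?_
  rw [mul_pow]
  have hw : 0 ≤ ‖w‖ ^ 3 := by positivity
  have hL : 0 ≤ (L : ℝ) ^ 4 := by positivity
  nlinarith [sqrt_three_pow_three_le, mul_nonneg hL hw]

end Summit.QuantumFields.YangMills.Theorems.SwapVirialDeficit.Gnomonic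

end
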